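import Summits.PneNP.PneNP.Theses.Circuit
import Literature.Computability.Complexity.NondeterministicProofs
import Literature.Computability.AlgebraicComplexity.CircuitDepth
import HarnessLib

/-!
# Line `Sketch` (cube-functional threshold dictionary) for the crux `CircuitNpTc0` (stmt-PneNP-0039)

Crux (route `Circuit`, rank 5): `Summit.PneNP.PneNP.Theses.Circuit.CircuitNpTc0 = ¬ (NP ⊆ TC0)`.

## The line (idea card `Ideas/cube-functional-threshold-dictionary.md`, lead's reshaped skeleton)

Witness language: the word problem `WS5` of `S₅` (Barrington), which is in `P ⊆ NP`
(`stub_WS5_mem_P`). It suffices to show `WS5 ∉ TC0`. Chain (all arrows proved below, the named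
steps are the registered stubs):

1. `WS5 ∈ TC0` (constant depth, polynomially many gates, repeated wires = ARBITRARY natural threshold
   weights in the tree's model) ⟹ constant depth and polynomially many WIRES
   (`stub_polyWires`: Goldmann–Karpinski 1998, exponential weights are simulated by unit weights at
   depth `+1` and polynomial cost).
2. Allender–Koucký / Chen–Tell bootstrapping: the block self-reduction of the word problem
   (`stub_selfReduction`: a circuit for `n`-bit words from circuits for `(t+1)`-letter words — one
   query `block · g⁻¹ ∈ WS5?` per block and group element — and a circuit for the `B`-letter word of
   block products) turns ANY polynomial wire bound into depth-`Δ` circuits with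
   `K · (⌈n^{1+c^{-Δ}}⌉ + 1)` wires for some `c > 1` and all large `Δ` (`stub_bootstrapArith`: the
   exponent excess shrinks by the factor `(k-1)/k` per round).
3. The dictionary (`stub_dictionary`, with the complex-root majority gadget `stub_majGadget`:
   `MAJ_m(y) = a · ∏ⱼ (∑ᵢ yᵢ − ρⱼ)` over `ℂ`): a depth-`d` threshold circuit with `W` wires is computed
   EXACTLY ON THE CUBE by an arithmetic circuit over `ℂ` of product-depth `≤ d` with `≤ 6W` edges.
4. Hence `WS5 ∈ CubeDepthEdges ℂ Δ (wireBudget c Δ (6K))` for all large `Δ`, contradicting the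
   transfer target `stub_cubeLowerBounds` (C⁺_A(ℂ) of the card: cube-functional edge lower bounds of
   exponent `1 + c^{-Δ}` for EVERY `c > 1` at infinitely many product-depths `Δ` — OPEN; the lead's stub).

Composition: `CircuitNpTc0_of` concludes the crux BY NAME from the seven stubs; sorries only in
`stub_*`. Definitions are duplicated verbatim from `Theorems/CircuitCircuitNpTc0Defs.lean` (p172982,
same namespace) until that file lands; then this block is replaced by the import.

Disproof items honoured (Cruxes/CircuitNpTc0/Disproof.lean v1): the size bound is load-bearing (§1:
every stub carries explicit wire/edge budgets; the witness `WS5` is dense, co-dense and non-symmetric,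
§3); the basis is full `tcBasis` incl. `MAJ` with multiplicities (§0 readback) — handled by
`stub_polyWires`, which the idea card had silently assumed.
-/

-- `Summit.<Summit>.<Problem>`: for the single-conjunct summit `PneNP` the duplicate `PneNP.PneNP` is mandated (D-0017).
set_option linter.dupNamespace false

namespace Summit.PneNP.PneNP.Cruxes.CircuitNpTc0.Sketch

open Literature.Computability.Complexity Literature.Computability.AlgebraicComplexity

/-! ## Definitions (verbatim copy of `Theorems/CircuitCircuitNpTc0Defs.lean`, pending p172982) -/

/-- The number of wires of a circuit: the sum of the arities of its gates (a wire read `m` times by a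
gate counts `m` times — in the tree's model this is how integer weights of threshold gates arise).
[cite: ImpagliazzoPaturiSaks1997, §1 (wires = edges of the circuit graph)] -/
def wires {ι : Type*} (C : Circuit ι) : ℕ := (C.gates.map Gate.arity).sum

/-- `DepthWires B d w`: languages decided by circuit families over the basis `B` of `acDepth ≤ d`
(negations free) with at most `w n` wires at length `n`. [cite: ChenTell2019, §1 (TC⁰ circuits of depth d with n^{1+c^{-d}} wires)] -/
noncomputable def DepthWires (B : Set GateFn) (d : ℕ) (w : ℕ → ℕ) : Set (Language Bool) :=
  {L | ∃ C : CircuitFamily, (∀ n, (C n).IsOver B ∧ (C n).acDepth ≤ d ∧ wires (C n) ≤ w n) ∧ C.Decides L}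

/-- The point of `kⁿ` under a Boolean vector: `true ↦ 1`, `false ↦ 0`. [folklore] -/
def cubePt {k : Type*} [Zero k] [One k] {n : ℕ} (x : Fin n → Bool) : Fin n → k :=
  fun i => if x i then 1 else 0

/-- `CubeComputes P f`: the polynomial computed by the arithmetic circuit `P` takes the value `[f x]`
at every point `x` of the Boolean cube (functional / cube-exact computation in the sense of
Forbes–Kumar–Saptharishi 2016, Def. 1.1; a predicate, not a named fact). [folklore] -/
def CubeComputes {k : Type*} [CommSemiring k] {n : ℕ} (P : ArithCircuit k (Fin n))
    (f : (Fin n → Bool) → Bool) : Prop :=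
  ∀ x : Fin n → Bool, MvPolynomial.eval (cubePt x) P.eval = if f x then 1 else 0

/-- `CubeDepthEdges k Δ e`: languages whose every slice is computed exactly on the cube by an
arithmetic circuit over `k` of product-depth `≤ Δ` with at most `e n` edges (size = number of edges,
as in Raz 2010 and Limaye–Srinivasan–Tavenas 2021). [cite: ForbesKumarSaptharishi2016, Def. 1.1] -/
def CubeDepthEdges (k : Type*) [CommSemiring k] (Δ : ℕ) (e : ℕ → ℕ) : Set (Language Bool) :=
  {L | ∃ F : ∀ n, ArithCircuit k (Fin n),
    ∀ n, (F n).productDepth ≤ Δ ∧ (F n).edgeSize ≤ e n ∧ CubeComputes (F n) (L.sliceFn n)}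

/-- The little-endian value of a `7`-bit block. [folklore] -/
def codeVal (c : Fin 7 → Bool) : ℕ := ∑ j : Fin 7, if c j then 2 ^ (j : ℕ) else 0

/-- `S₅` has `120` elements. [folklore] -/
theorem card_perm_fin_five : Fintype.card (Equiv.Perm (Fin 5)) = 120 := by
  rw [Fintype.card_perm, Fintype.card_fin]; rfl

/-- The permutation named by a `7`-bit block: values `< 120` enumerate `Equiv.Perm (Fin 5)` through
`Fintype.equivFin`, every other value denotes the identity. [cite: Barrington1989, §4 (word problem of S₅ over a fixed letter encoding)] -/
noncomputable def permOfCode (c : Fin 7 → Bool) : Equiv.Perm (Fin 5) :=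
  if h : codeVal c < 120 then
    (Fintype.equivFin (Equiv.Perm (Fin 5))).symm (Fin.cast card_perm_fin_five.symm ⟨codeVal c, h⟩)
  else 1

/-- Position of bit `j` of block `i` in a string of length `n`: `7 i + j`. [folklore] -/
def blockBit (n : ℕ) (i : Fin (n / 7)) (j : Fin 7) : Fin n :=
  ⟨7 * (i : ℕ) + j, by have := i.isLt; have := j.isLt; omega⟩

/-- The ordered product of the `⌊n/7⌋` permutations named by the blocks of a bit vector of length
`n` (trailing `n mod 7` bits are ignored). [cite: Barrington1989, §4] -/
noncomputable def wordProd (n : ℕ) (x : Fin n → Bool) : Equiv.Perm (Fin 5) :=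
  (List.ofFn fun i : Fin (n / 7) => permOfCode fun j => x (blockBit n i j)).prod

/-- **The word problem of `S₅`**: bit strings whose blocks multiply to the identity
(`NC¹`-complete under projections, Barrington 1989). [cite: Barrington1989, Thm. 5 (word problem of a non-solvable group is NC¹-complete)] -/
def WS5 : Language Bool := {x | wordProd x.length x.get = 1}

/-- The wire budget `K · (⌈n ^ (1 + c^{-Δ})⌉ + 1)` at depth `Δ` (`c > 1`, constant `K`).
[cite: ChenTell2019, Thm. 1.1 (n^{1+c^{-d}} wires at depth d)] -/
noncomputable def wireBudget (c : ℝ) (Δ K n : ℕ) : ℕ := K * (⌈(n : ℝ) ^ (1 + (c ^ Δ)⁻¹)⌉₊ + 1)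

/-! ## The stubs -/

/-- **stub_majGadget — the complex-root majority gadget (S).** The step `j ↦ [m ≤ 2j]` on
`{0, …, m}` is interpolated by a polynomial of degree `≤ m` over `ℂ`, which splits: so there are
`a ∈ ℂ` and at most `m` roots `ρ` with `a · ∏ (j - ρᵢ) = [m ≤ 2j]` for all `j ≤ m`. Hence a majority
gate of fan-in `m` is ONE product of `≤ m` affine forms in `∑ yᵢ` on the cube.
(Lagrange interpolation + `IsAlgClosed ℂ`.) [folklore] -/
theorem stub_majGadget (m : ℕ) :
    ∃ (a : ℂ) (ρ : List ℂ), ρ.length ≤ m ∧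
      ∀ j : ℕ, j ≤ m → a * (ρ.map fun r => (j : ℂ) - r).prod = if m ≤ 2 * j then 1 else 0 := by
  sorry

/-- **stub_dictionary — threshold circuits are cube-exact `Σ/Π`-circuits over `ℂ`, depth preserved,
edges linear in wires (L).** Given the majority gadget, every circuit over `tcBasis` of `acDepth ≤ d`
is computed exactly on `{0,1}ⁿ` by an arithmetic circuit over `ℂ` of product-depth `≤ d` with at most
`6 ·` (number of wires) edges: `¬y ↦ 1 - y` (a sum gate, product-depth `0`, as negations are free in
`acDepth`), `∧ₖ ↦ ∏ yᵢ`, `∨ₖ ↦ 1 - ∏ (1 - yᵢ)`, `MAJₖ ↦ a · ∏ⱼ (s - ρⱼ)` with `s = ∑ yᵢ` shared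
(`k + 2k + (k+1) ≤ 6k` edges; arity-`0` gates are the constants `∏ ∅ = 1`, `∑ ∅ = 0`), by induction
along the gate list (`ArithCircuit.gateVal` / `gatePD` bookkeeping of `CircuitGateSemantics.lean`).
[folklore] -/
theorem stub_dictionary
    (hmaj : ∀ m : ℕ, ∃ (a : ℂ) (ρ : List ℂ), ρ.length ≤ m ∧
      ∀ j : ℕ, j ≤ m → a * (ρ.map fun r => (j : ℂ) - r).prod = if m ≤ 2 * j then 1 else 0)
    {n : ℕ} (d : ℕ) (C : Circuit (Fin n)) (hB : C.IsOver tcBasis) (hd : C.acDepth ≤ d) :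
    ∃ F : ArithCircuit ℂ (Fin n), F.productDepth ≤ d ∧
      F.edgeSize ≤ 6 * (C.gates.map Gate.arity).sum ∧
      ∀ x : Fin n → Bool,
        MvPolynomial.eval (fun i => if x i then (1 : ℂ) else 0) F.eval = if C.eval x then 1 else 0 := by
  sorry

/-- **stub_polyWires — exponential weights cost one extra layer (XL; Goldmann–Karpinski 1998,
Goldmann–Håstad–Razborov 1992).** For every depth `d` there are `D` and `k` such that every circuit
over `tcBasis` of `acDepth ≤ d` with `s` gates on `n` inputs (gates may read a wire many times: its
`MAJ` gates are thresholds of their distinct sources with arbitrary natural weights, reducible to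
weights `≤ (M+1)!` by `ThresholdWeights.exists_literal_threshold`) is equivalent to a circuit over
`tcBasis` of `acDepth ≤ D` with at most `(s + n + 2)^k` WIRES. (`∧`/`∨`: deduplicate sources; `MAJ`:
GK98 Thm. 1, `LT_d ⊆ LT̂_{d+1}` with polynomial blow-up.) [cite: GoldmannKarpinski1998, Thm. 1] -/
theorem stub_polyWires (d : ℕ) : ∃ D k : ℕ, ∀ (n : ℕ) (C : Circuit (Fin n)),
    C.IsOver tcBasis → C.acDepth ≤ d →
      ∃ C' : Circuit (Fin n), C'.IsOver tcBasis ∧ C'.acDepth ≤ D ∧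
        (C'.gates.map Gate.arity).sum ≤ (C.size + n + 2) ^ k ∧ ∀ x, C'.eval x = C.eval x := by
  sorry

/-- **stub_selfReduction — the block self-reduction of the word problem (L; Allender–Koucký 2010 §3,
for this encoding).** From a circuit `C₁` deciding `WS5` on `(t+1)`-letter words (`7t+7` bits) and a
circuit `C₂` deciding `WS5` on `B`-letter words, with `t · B ≥ ⌊n/7⌋`, build a circuit deciding `WS5`
on `n`-bit words: cut the `⌊n/7⌋` letters into `B` blocks of `≤ t` letters (pad with the identity,
code `127`); for each block `β` and each `g ∈ S₅` one copy of `C₁` on `β ++ code(g⁻¹)` answers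
`[∏ β = g]`; bit `j` of `code (∏ β)` is the `∨` over `{g | bit j of code g}` of these answers (one
layer); feed the `7B` bits to `C₂`. Depth `d₁ + d₂ + 2`, wires `≤ 128·B·(W₁ + 8) + W₂ + 8` (generous).
[cite: AllenderKoucky2010, §3 (self-reduction of the word problem)] -/
theorem stub_selfReduction (t : ℕ) (ht : 0 < t) (n B : ℕ) (hB : n / 7 ≤ t * B) {d₁ d₂ W₁ W₂ : ℕ}
    (C₁ : Circuit (Fin (7 * t + 7))) (h₁B : C₁.IsOver tcBasis) (h₁d : C₁.acDepth ≤ d₁)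
    (h₁w : (C₁.gates.map Gate.arity).sum ≤ W₁) (h₁c : ∀ x, C₁.eval x = WS5.sliceFn (7 * t + 7) x)
    (C₂ : Circuit (Fin (7 * B))) (h₂B : C₂.IsOver tcBasis) (h₂d : C₂.acDepth ≤ d₂)
    (h₂w : (C₂.gates.map Gate.arity).sum ≤ W₂) (h₂c : ∀ x, C₂.eval x = WS5.sliceFn (7 * B) x) :
    ∃ C : Circuit (Fin n), C.IsOver tcBasis ∧ C.acDepth ≤ d₁ + d₂ + 2 ∧
      (C.gates.map Gate.arity).sum ≤ 128 * B * (W₁ + 8) + W₂ + 8 ∧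
      ∀ x, C.eval x = WS5.sliceFn n x := by
  sorry

/-- **stub_bootstrapArith — the Chen–Tell exponent bookkeeping (M; pure real analysis).** For an
abstract solvability predicate `S depth wires length`, monotone in depth and wires, a polynomial
initial bound `(n+2)^k` at some depth and the block recursion of `stub_selfReduction` give, for some
`c > 1` and all large depths `Δ`, the wire bound `K · (⌈n^{1+c^{-Δ}}⌉ + 1)`: with `t ≈ n^β`,
`β = e/(k+e)`, one round turns exponent `1+e` at depth `D` into `1 + e(k-1)/(k+e) ≤ 1 + e·(k-1)/k` at
depth `D + d₀ + 2`, so after `j` rounds the excess is `≤ (k-1)((k-1)/k)^j`, i.e. `≤ c^{-Δ}` for any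
`1 < c < (k/(k-1))^{1/(d₀+2)}` and `Δ` large (monotonicity in depth fills the gaps; `k ≤ 1` is trivial).
[cite: ChenTell2019, Thm. 1.1 (proof: bootstrapping the Allender–Koucký recursion)] -/
theorem stub_bootstrapArith (S : ℕ → ℕ → ℕ → Prop)
    (hmono : ∀ d d' W W' n : ℕ, d ≤ d' → W ≤ W' → S d W n → S d' W' n)
    (hinit : ∃ d₀ k : ℕ, ∀ n : ℕ, S d₀ ((n + 2) ^ k) n)
    (hrec : ∀ t : ℕ, 0 < t → ∀ n B : ℕ, n / 7 ≤ t * B → ∀ d₁ d₂ W₁ W₂ : ℕ,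
      S d₁ W₁ (7 * t + 7) → S d₂ W₂ (7 * B) → S (d₁ + d₂ + 2) (128 * B * (W₁ + 8) + W₂ + 8) n) :
    ∃ c : ℝ, 1 < c ∧ ∃ Δ₁ : ℕ, ∀ Δ : ℕ, Δ₁ ≤ Δ → ∃ K : ℕ, ∀ n : ℕ,
      S Δ (K * (⌈(n : ℝ) ^ (1 + (c ^ Δ)⁻¹)⌉₊ + 1)) n := by
  sorry

/-- **stub_WS5_mem_P — the word problem of `S₅` is in `P` (M).** A finite-state transducer with
states `S₅ × (Fin 7 → Bool) × Fin 7` (running product, current block buffer, position in the block)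
outputs `[product = 1]`; `mem_P_of_fst`. [cite: Barrington1989, §4 (the word problem is a regular language)] -/
theorem stub_WS5_mem_P : WS5 ∈ Classes.P := by
  sorry

/-- **stub_cubeLowerBounds — the transfer target C⁺_A(ℂ) (OPEN; the lead's stub).** For every
`c > 1` and infinitely many product-depths `Δ`, the word problem `WS5` has no cube-exact arithmetic
circuits over `ℂ` of product-depth `≤ Δ` with `K · (⌈n^{1+c^{-Δ}}⌉ + 1)` edges, for any `K`.
A model in which PARITY, `MOD_m` and all symmetric functions cost `O(n)` edges at product-depth `1`;
the first rung (product-depth `2`, any fixed exponent `> 1`) is already open. [folklore] -/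
theorem stub_cubeLowerBounds : ∀ c : ℝ, 1 < c → ∀ Δ₁ : ℕ, ∃ Δ : ℕ, Δ₁ ≤ Δ ∧
    ∀ K : ℕ, WS5 ∉ CubeDepthEdges ℂ Δ (wireBudget c Δ K) := by
  sorry

/-! ## Glue (proved) -/

/-- A family computing the slices decides the language. [folklore] -/
theorem decides_of_eval_sliceFn {L : Language Bool} {C : CircuitFamily}
    (h : ∀ n x, (C n).eval x = L.sliceFn n x) : C.Decides L := by
  intro x
  rw [h]
  show L.boolIndicator (List.ofFn x.get) = L.boolIndicator x
  rw [List.ofFn_get]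

/-- A deciding family computes the slices. [folklore] -/
theorem eval_eq_sliceFn_of_decides {L : Language Bool} {C : CircuitFamily} (h : C.Decides L)
    (n : ℕ) (x : Fin n → Bool) : (C n).eval x = L.sliceFn n x :=
  h.eval_eq x

/-- `wireBudget` absorbs constant factors: `a · wireBudget c Δ K = wireBudget c Δ (a K)`. [folklore] -/
theorem mul_wireBudget (a : ℕ) (c : ℝ) (Δ K n : ℕ) :
    a * wireBudget c Δ K n = wireBudget c Δ (a * K) n := by
  unfold wireBudget; ring

/-- **Dictionary + C⁺ ⟹ Boolean wire lower bounds.** If depth-`Δ` threshold circuits with `W` wires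
are cube-exact product-depth-`Δ` circuits with `6W` edges, the cube lower bounds for `WS5` give: for
every `c > 1` and infinitely many `Δ`, `WS5 ∉ DepthWires tcBasis Δ (wireBudget c Δ K)` for all `K`.
[folklore] -/
theorem ws5_wireLowerBounds
    (hdict : ∀ {n : ℕ} (d : ℕ) (C : Circuit (Fin n)), C.IsOver tcBasis → C.acDepth ≤ d →
      ∃ F : ArithCircuit ℂ (Fin n), F.productDepth ≤ d ∧
        F.edgeSize ≤ 6 * (C.gates.map Gate.arity).sum ∧
        ∀ x : Fin n → Bool,
          MvPolynomial.eval (fun i => if x i then (1 : ℂ) else 0) F.eval = if C.eval x then 1 else 0)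
    (hcube : ∀ c : ℝ, 1 < c → ∀ Δ₁ : ℕ, ∃ Δ : ℕ, Δ₁ ≤ Δ ∧
      ∀ K : ℕ, WS5 ∉ CubeDepthEdges ℂ Δ (wireBudget c Δ K)) :
    ∀ c : ℝ, 1 < c → ∀ Δ₁ : ℕ, ∃ Δ : ℕ, Δ₁ ≤ Δ ∧
      ∀ K : ℕ, WS5 ∉ DepthWires tcBasis Δ (wireBudget c Δ K) := by
  intro c hc Δ₁
  obtain ⟨Δ, hΔ, hK⟩ := hcube c hc Δ₁
  refine ⟨Δ, hΔ, fun K hmem => ?_⟩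
  obtain ⟨C, hC, hdec⟩ := hmem
  apply hK (6 * K)
  choose F hF using fun n => hdict Δ (C n) (hC n).1 (hC n).2.1
  refine ⟨F, fun n => ⟨(hF n).1, ?_, fun x => ?_⟩⟩
  · calc (F n).edgeSize ≤ 6 * ((C n).gates.map Gate.arity).sum := (hF n).2.1
      _ ≤ 6 * wireBudget c Δ K n := Nat.mul_le_mul_left 6 (hC n).2.2
      _ = wireBudget c Δ (6 * K) n := mul_wireBudget 6 c Δ K n
  · have h := (hF n).2.2 x
    rw [eval_eq_sliceFn_of_decides hdec n x] at h
    exact h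

/-- Every `ℕ`-polynomial plus `n + 2` is dominated by a power of `n + 2`. [folklore] -/
theorem exists_eval_add_le_pow_add_two (p : Polynomial ℕ) :
    ∃ m : ℕ, ∀ n : ℕ, p.eval n + n + 2 ≤ (n + 2) ^ m := by
  obtain ⟨C, K, h⟩ := exists_eval_le_mul_pow_add p
  refine ⟨C + 1 + K + 1, fun n => ?_⟩
  set b := n + 2 with hb
  have hb2 : 2 ≤ b := by omega
  have h1 : n ^ K ≤ b ^ K := Nat.pow_le_pow_left (by omega) K
  have h2 : 1 ≤ b ^ K := Nat.one_le_pow _ _ (by omega)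
  have h3 : 2 * C ≤ 2 ^ (C + 1) := by
    have : C < 2 ^ C := Nat.lt_two_pow_self
    rw [pow_succ]; omega
  have h4 : 2 ^ (C + 1) ≤ b ^ (C + 1) := Nat.pow_le_pow_left hb2 _
  have h5 : b ≤ b ^ (C + 1 + K) := by
    calc b = b ^ 1 := (pow_one b).symm
      _ ≤ b ^ (C + 1 + K) := Nat.pow_le_pow_right (by omega) (by omega)
  have h6 : C * n ^ K + C ≤ b ^ (C + 1 + K) := by
    calc C * n ^ K + C ≤ C * b ^ K + C * b ^ K := by
          have := Nat.mul_le_mul_left C h1; have := Nat.mul_le_mul_left C h2; omega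
      _ = 2 * C * b ^ K := by ring
      _ ≤ 2 ^ (C + 1) * b ^ K := Nat.mul_le_mul_right _ h3
      _ ≤ b ^ (C + 1) * b ^ K := Nat.mul_le_mul_right _ h4
      _ = b ^ (C + 1 + K) := (pow_add b _ _).symm
  calc p.eval n + n + 2 = p.eval n + b := by omega
    _ ≤ b ^ (C + 1 + K) + b ^ (C + 1 + K) := Nat.add_le_add ((h n).trans h6) h5
    _ = 2 * b ^ (C + 1 + K) := by ring
    _ ≤ b * b ^ (C + 1 + K) := Nat.mul_le_mul_right _ hb2
    _ = b ^ (C + 1 + K + 1) := by ring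

/-- Per-length solvability of `WS5` by sparse threshold circuits: depth `≤ d`, `≤ W` wires. [folklore] -/
def Solv (d W n : ℕ) : Prop :=
  ∃ C : Circuit (Fin n), C.IsOver tcBasis ∧ C.acDepth ≤ d ∧ (C.gates.map Gate.arity).sum ≤ W ∧
    ∀ x, C.eval x = WS5.sliceFn n x

/-- **Bootstrapping + wire lower bounds ⟹ `WS5 ∉ TC0`.** [folklore] -/
theorem ws5_not_mem_TC0
    (hpoly : ∀ d : ℕ, ∃ D k : ℕ, ∀ (n : ℕ) (C : Circuit (Fin n)),
      C.IsOver tcBasis → C.acDepth ≤ d →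
        ∃ C' : Circuit (Fin n), C'.IsOver tcBasis ∧ C'.acDepth ≤ D ∧
          (C'.gates.map Gate.arity).sum ≤ (C.size + n + 2) ^ k ∧ ∀ x, C'.eval x = C.eval x)
    (hself : ∀ (t : ℕ), 0 < t → ∀ (n B : ℕ), n / 7 ≤ t * B → ∀ {d₁ d₂ W₁ W₂ : ℕ}
      (C₁ : Circuit (Fin (7 * t + 7))), C₁.IsOver tcBasis → C₁.acDepth ≤ d₁ →
      (C₁.gates.map Gate.arity).sum ≤ W₁ → (∀ x, C₁.eval x = WS5.sliceFn (7 * t + 7) x) →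
      ∀ (C₂ : Circuit (Fin (7 * B))), C₂.IsOver tcBasis → C₂.acDepth ≤ d₂ →
      (C₂.gates.map Gate.arity).sum ≤ W₂ → (∀ x, C₂.eval x = WS5.sliceFn (7 * B) x) →
      ∃ C : Circuit (Fin n), C.IsOver tcBasis ∧ C.acDepth ≤ d₁ + d₂ + 2 ∧
        (C.gates.map Gate.arity).sum ≤ 128 * B * (W₁ + 8) + W₂ + 8 ∧
        ∀ x, C.eval x = WS5.sliceFn n x)
    (harith : ∀ S : ℕ → ℕ → ℕ → Prop,
      (∀ d d' W W' n : ℕ, d ≤ d' → W ≤ W' → S d W n → S d' W' n) →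
      (∃ d₀ k : ℕ, ∀ n : ℕ, S d₀ ((n + 2) ^ k) n) →
      (∀ t : ℕ, 0 < t → ∀ n B : ℕ, n / 7 ≤ t * B → ∀ d₁ d₂ W₁ W₂ : ℕ,
        S d₁ W₁ (7 * t + 7) → S d₂ W₂ (7 * B) → S (d₁ + d₂ + 2) (128 * B * (W₁ + 8) + W₂ + 8) n) →
      ∃ c : ℝ, 1 < c ∧ ∃ Δ₁ : ℕ, ∀ Δ : ℕ, Δ₁ ≤ Δ → ∃ K : ℕ, ∀ n : ℕ,
        S Δ (K * (⌈(n : ℝ) ^ (1 + (c ^ Δ)⁻¹)⌉₊ + 1)) n)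
    (hlow : ∀ c : ℝ, 1 < c → ∀ Δ₁ : ℕ, ∃ Δ : ℕ, Δ₁ ≤ Δ ∧
      ∀ K : ℕ, WS5 ∉ DepthWires tcBasis Δ (wireBudget c Δ K)) :
    WS5 ∉ TC0 := by
  rintro ⟨d, p, C, hC, hdec⟩
  -- the abstract bootstrapping applied to `Solv`
  have hmono : ∀ d d' W W' n : ℕ, d ≤ d' → W ≤ W' → Solv d W n → Solv d' W' n := by
    rintro d d' W W' n hd hW ⟨C, h1, h2, h3, h4⟩
    exact ⟨C, h1, h2.trans hd, h3.trans hW, h4⟩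
  have hinit : ∃ d₀ k : ℕ, ∀ n : ℕ, Solv d₀ ((n + 2) ^ k) n := by
    obtain ⟨D, k, hDk⟩ := hpoly d
    obtain ⟨m, hm⟩ := exists_eval_add_le_pow_add_two p
    refine ⟨D, m * k, fun n => ?_⟩
    obtain ⟨C', h1, h2, h3, h4⟩ := hDk n (C n) (hC n).1 (hC n).2.1
    refine ⟨C', h1, h2, h3.trans ?_, fun x => ?_⟩
    · calc ((C n).size + n + 2) ^ k ≤ (p.eval n + n + 2) ^ k :=
            Nat.pow_le_pow_left (by have hs : (C n).size ≤ p.eval n := (hC n).2.2; omega) k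
        _ ≤ ((n + 2) ^ m) ^ k := Nat.pow_le_pow_left (hm n) k
        _ = (n + 2) ^ (m * k) := (pow_mul _ _ _).symm
    · rw [h4 x, eval_eq_sliceFn_of_decides hdec n x]
  have hrec : ∀ t : ℕ, 0 < t → ∀ n B : ℕ, n / 7 ≤ t * B → ∀ d₁ d₂ W₁ W₂ : ℕ,
      Solv d₁ W₁ (7 * t + 7) → Solv d₂ W₂ (7 * B) →
        Solv (d₁ + d₂ + 2) (128 * B * (W₁ + 8) + W₂ + 8) n := by
    rintro t ht n B hB d₁ d₂ W₁ W₂ ⟨C₁, h₁B, h₁d, h₁w, h₁c⟩ ⟨C₂, h₂B, h₂d, h₂w, h₂c⟩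
    exact hself t ht n B hB C₁ h₁B h₁d h₁w h₁c C₂ h₂B h₂d h₂w h₂c
  obtain ⟨c, hc, Δ₁, hΔ⟩ := harith Solv hmono hinit hrec
  obtain ⟨Δ, hΔ₁, hK⟩ := hlow c hc Δ₁
  obtain ⟨K, hKn⟩ := hΔ Δ hΔ₁
  apply hK K
  choose C' hC' using hKn
  exact ⟨C', fun n => ⟨(hC' n).1, (hC' n).2.1, (hC' n).2.2.1⟩,
    decides_of_eval_sliceFn fun n x => (hC' n).2.2.2 x⟩

/-- **The composition: the seven stubs prove the crux `¬ (NP ⊆ TC0)`.** `WS5 ∈ P ⊆ NP`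
(`stub_WS5_mem_P`, `P_subset_NP_holds`), so `NP ⊆ TC0` would put `WS5 ∈ TC0`, contradicting
`ws5_not_mem_TC0` fed with `stub_polyWires`, `stub_selfReduction`, `stub_bootstrapArith` and the wire
lower bounds `ws5_wireLowerBounds (stub_dictionary stub_majGadget) stub_cubeLowerBounds`. [folklore] -/
theorem CircuitNpTc0_of : Summit.PneNP.PneNP.Theses.Circuit.CircuitNpTc0 := by
  intro hNP
  have hTC : WS5 ∈ TC0 := hNP (P_subset_NP_holds stub_WS5_mem_P)
  exact ws5_not_mem_TC0 stub_polyWires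
    (fun t ht n B hB _ _ _ _ C₁ h₁B h₁d h₁w h₁c C₂ h₂B h₂d h₂w h₂c =>
      stub_selfReduction t ht n B hB C₁ h₁B h₁d h₁w h₁c C₂ h₂B h₂d h₂w h₂c)
    stub_bootstrapArith
    (ws5_wireLowerBounds (fun d C hB hd => stub_dictionary stub_majGadget d C hB hd)
      stub_cubeLowerBounds)
    hTC

end Summit.PneNP.PneNP.Cruxes.CircuitNpTc0.Sketch
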